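/-
Copyright (c) 2026 the pub-hodgecm-mathlib formalisation cell (harness21).  Prover seat hodgecm-mathlib-K2Liu-p10 (g0), Track B «K2-LIT»,
#184♮ = hLiu418 = `stmt-HodgeConjecture-24832`; LEAD F0P6-plan (g11) RE-DEAL 2026-09-04T05:43:59Z «(D-arch) → K2Liu-p10»: #33b (D), generic half —
from a main-orbit CHART (open embedding `P × G → H` with closed `P·j(C)`) and a character `δ` of `P`, every compactly supported continuous `g` on `G`
extends to a continuous `δ`-equivariant SECTION on `H`; plus the Urysohn bump on a locally compact group.
-/
import Mathlib.Topology.UrysohnsLemma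
import Mathlib.Topology.Algebra.Support
import HarnessLib

/-!
# Crux `HLiu418`, road `K2_Liu`, socket #33b organ (D), generic half: SECTIONS SUPPORTED ON THE MAIN ORBIT, from the chart

Cell `hodgecm-mathlib`, crux item hLiu418 = `stmt-HodgeConjecture-24832`; squad K2, LEAD F0P6-plan (g11∕g12), box K2E5-r01 (g6), consumer K2Liu-p11 (g0)
(#33b closer `siegelBigCellSection_of_localPackages (hArch) (hFin)`; this file feeds (hArch) through `K2LiuSiegelMainOrbitArchSection`).  THEOREMS ONLY
(Mathlib only; no `def`, no instance, no notation, no named-fact hypothesis, no `sorry`); lane `--supports stmt-HodgeConjecture-24832 --as helper`.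

THE CONSTRUCTION (`exists_section_of_isOpenEmbedding`).  `H` a topological group, `P ≤ H`, `G` a topological space, `j : G → H`, and the CHART
`m : P × G → H`, `m(p, x) = p·j(x)` — assumed an OPEN EMBEDDING (`hemb`; ★ (C1) `isOpenEmbedding_siegel_mul_iotaArch` at `∞`, ★ (B) at finite places)
with `m(P × C)` CLOSED for compact `C` (`hcl`; ★ (C4) = (D1)).  For a multiplicative `δ : P → A` (`δ(1) = 1`, continuous on `P`) and a continuous
compactly supported `g : G → A`: the function `φ := δ ⊗ g` on the open range `Ω = m(P × G)` (through the chart), `0` off `Ω`, is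
(i) CONTINUOUS on `H` (on `Ω` through the open embedding; near a point outside the closed `m(P × tsupport g) ⊆ Ω` it vanishes identically),
(ii) a SECTION: `φ(p·h) = δ(p)·φ(h)` (`Ω` is left-`P`-stable, `P·Ωᶜ = Ωᶜ`), (iii) READS BACK `φ(j x) = g(x)`, (iv) `support φ ⊆ m(P × tsupport g)`.
THE BUMP (`exists_continuous_hasCompactSupport_pos`): in a locally compact `R₁` space every open neighbourhood `U ∋ x₀` carries a continuous
`g ≥ 0` with compact support inside `U` and `g(x₀) > 0` (Urysohn on a relatively compact neighbourhood).
[GelbartPiatetskishapiroRallis1987, Part A §1 (good sections supported on the main orbit)] [Liu2011, §2C p. 863] [BorelJacquet1979, §4.1].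
HONEST LABEL.  Count-neutral helper; `HC_CM` is proved only modulo the 7 printed citations (2 remaining named inputs: hLiu418 = `stmt-HodgeConjecture-24832`,
h413 = `stmt-HodgeConjecture-24833`) until rung 0 closes.
-/

set_option autoImplicit false
set_option linter.dupNamespace false -- the mandated namespace repeats `HodgeConjecture.HodgeConjecture`

namespace Summit.HodgeConjecture.HodgeConjecture.Cruxes.HLiu418.K2LiuSiegelMainOrbitSectionOfChart

open Topology Filter Set Function

/-! ## §1 The bump -/

/-- **Urysohn bump at a point**: in a locally compact Hausdorff space, every open `U ∋ x₀` supports a continuous `g : X → ℝ`, `0 ≤ g ≤ 1`,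
with COMPACT support contained in `U` and `g(x₀) = 1 > 0`. [cite: BorelJacquet1979, §4.1] -/
theorem exists_continuous_hasCompactSupport_pos {X : Type*} [TopologicalSpace X] [T2Space X] [LocallyCompactSpace X]
    (x₀ : X) {U : Set X} (hU : IsOpen U) (hx : x₀ ∈ U) :
    ∃ g : X → ℝ, Continuous g ∧ HasCompactSupport g ∧ 0 ≤ g ∧ Function.support g ⊆ U ∧ 0 < g x₀ := by
  obtain ⟨K, hK, hxK, hKU⟩ := exists_compact_subset hU hx
  have hcl : IsCompact (closure (interior K)) :=
    hK.of_isClosed_subset isClosed_closure (closure_minimal interior_subset hK.isClosed)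
  obtain ⟨f, hfs, hf1, hf01⟩ :=
    exists_tsupport_one_of_isOpen_isClosed isOpen_interior hcl isClosed_singleton (Set.singleton_subset_iff.2 hxK)
  refine ⟨f, f.continuous, hK.of_isClosed_subset (isClosed_tsupport _) (hfs.trans interior_subset), fun x => (hf01 x).1,
    (subset_tsupport _).trans (hfs.trans (interior_subset.trans hKU)), ?_⟩
  have h1 : f x₀ = 1 := hf1 (Set.mem_singleton x₀)
  rw [h1]
  exact one_pos

/-! ## §2 The section attached to a bump through the chart -/

/-- **THE SECTION `δ ⊗ g` ON THE MAIN ORBIT.**  For an open-embedding chart `m(p, x) = p·j(x) : P × G → H` with `m(P × C)` closed for compact `C`,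
a multiplicative continuous `δ` on `P` with `δ(1) = 1`, and a continuous compactly supported `g` on `G`, there is `φ : H → A` CONTINUOUS with
`φ(p·h) = δ(p)·φ(h)` (`p ∈ P`), `φ(j x) = g(x)`, and `support φ ⊆ m(P × tsupport g)`.
[cite: GelbartPiatetskishapiroRallis1987, Part A §1] [cite: Liu2011, §2C p. 863] [cite: BorelJacquet1979, §4.1] -/
theorem exists_section_of_isOpenEmbedding {H : Type*} [Group H] [TopologicalSpace H]
    (P : Subgroup H) {G : Type*} [TopologicalSpace G] (j : G → H)
    (hemb : IsOpenEmbedding (fun px : P × G => (px.1 : H) * j px.2))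
    (hcl : ∀ C : Set G, IsCompact C → IsClosed ((fun px : P × G => (px.1 : H) * j px.2) '' (Set.univ ×ˢ C)))
    {A : Type*} [MonoidWithZero A] [TopologicalSpace A] [ContinuousMul A]
    (δ : H → A) (hδ : ∀ p ∈ P, ∀ q ∈ P, δ (p * q) = δ p * δ q) (hδ1 : δ 1 = 1) (hδc : Continuous fun p : P => δ p)
    (g : G → A) (hg : Continuous g) (hgc : HasCompactSupport g) :
    ∃ φ : H → A, Continuous φ ∧ (∀ p ∈ P, ∀ h, φ (p * h) = δ p * φ h) ∧ (∀ x, φ (j x) = g x) ∧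
      Function.support φ ⊆ (fun px : P × G => (px.1 : H) * j px.2) '' (Set.univ ×ˢ tsupport g) := by
  -- the chart `m`, the density `F = δ ⊗ g`, and `φ := F` pushed forward along `m`, `0` elsewhere
  set m : P × G → H := fun px => (px.1 : H) * j px.2 with hm
  set F : P × G → A := fun px => δ px.1 * g px.2 with hF
  have hFc : Continuous F := (hδc.comp continuous_fst).mul (hg.comp continuous_snd)
  have hφm : ∀ q, Function.extend m F 0 (m q) = F q := fun q => hemb.injective.extend_apply F 0 q
  have hφout : ∀ h, h ∉ Set.range m → Function.extend m F 0 h = 0 := fun h hh => by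
    rw [Function.extend_apply' _ _ _ (by simpa only [Set.mem_range] using hh)]
    rfl
  -- `φ = 0` off the closed set `S = m(P × tsupport g)`
  have hS : IsClosed (m '' (Set.univ ×ˢ tsupport g)) := hcl _ hgc
  have hφS : ∀ h, h ∉ m '' (Set.univ ×ˢ tsupport g) → Function.extend m F 0 h = 0 := by
    intro h hh
    by_cases hr : h ∈ Set.range m
    · obtain ⟨⟨q, x⟩, rfl⟩ := hr
      have hgx : g x = 0 := by
        by_contra hne
        exact hh ⟨(q, x), ⟨Set.mem_univ _, subset_tsupport g (Function.mem_support.2 hne)⟩, rfl⟩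
      rw [hφm]
      change δ q * g x = 0
      rw [hgx, mul_zero]
    · exact hφout h hr
  refine ⟨Function.extend m F 0, ?_, ?_, ?_, ?_⟩
  · -- continuity: through the open embedding on the range, identically `0` near a point off `S`
    refine continuous_iff_continuousAt.2 fun h => ?_
    by_cases hh : h ∈ m '' (Set.univ ×ˢ tsupport g)
    · obtain ⟨q, -, rfl⟩ := hh
      have hcomp : Function.extend m F 0 ∘ m = F := funext hφm
      exact hemb.continuousAt_iff.1 (by rw [hcomp]; exact hFc.continuousAt)
    · have hev : (fun _ : H => (0 : A)) =ᶠ[𝓝 h] Function.extend m F 0 :=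
        Filter.eventuallyEq_of_mem (hS.isOpen_compl.mem_nhds hh) fun y hy => (hφS y hy).symm
      exact continuousAt_const.congr hev
  · -- the section law
    intro p hp h
    by_cases hh : h ∈ Set.range m
    · obtain ⟨⟨q, x⟩, rfl⟩ := hh
      have hmul : p * m (q, x) = m (⟨p, hp⟩ * q, x) := by
        simp only [hm, Subgroup.coe_mul, mul_assoc]
      rw [hmul, hφm, hφm]
      change δ (p * (q : H)) * g x = δ p * (δ q * g x)
      rw [hδ p hp q q.2, mul_assoc]
    · have hph : p * h ∉ Set.range m := by
        rintro ⟨⟨q, x⟩, hq⟩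
        refine hh ⟨(⟨p, hp⟩⁻¹ * q, x), ?_⟩
        change (((⟨p, hp⟩ : P)⁻¹ * q : P) : H) * j x = h
        rw [Subgroup.coe_mul, Subgroup.coe_inv, mul_assoc]
        exact inv_mul_eq_of_eq_mul hq
      rw [hφout _ hph, hφout _ hh, mul_zero]
  · -- read-back along `j`
    intro x
    have hjx : j x = m (1, x) := by
      simp only [hm, OneMemClass.coe_one, one_mul]
    rw [hjx, hφm]
    change δ ((1 : P) : H) * g x = g x
    rw [OneMemClass.coe_one, hδ1, one_mul]
  · -- support
    intro h hh
    by_contra hS'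
    exact hh (hφS h hS')

end Summit.HodgeConjecture.HodgeConjecture.Cruxes.HLiu418.K2LiuSiegelMainOrbitSectionOfChart
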